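import Summits.ValiantsHypothesis.ValiantsHypothesis.Theorems.BarrierLeverChowBenchmarkPairsPeelGeneric

/-!
# Route BarrierLever — item 22038 `ChowBenchmarkPairs`, line `moore-peel`: the TROPICAL (weighted one-point) PEELING
# LEMMA — the non-rigid extension step of the peeling engine

Helper file (`--supports stmt-ValiantsHypothesis-22038`; cell valiant-natproofs, rung V4, 𝒟-side benchmark of record;
seat val-np-p4 gen 22).  Closes NO item.

The rigid peeling lemma (`…PeelGeneric.lean`, `det_symbMatrixQ_ne_zero`) adjoins a new point `q + x·𝟙_A` and reads the
top `x`-coefficient of the determinant; it needs EXACTLY `n+1` columns above `A` (all of them new).  THIS FILE replaces the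
indicator `𝟙_A` by an arbitrary WEIGHT VECTOR `w : κ → ℕ`: the new point is `c ↦ q_c · x^{w c}` (a one-parameter torus orbit
through the generic point `q`).  Every new row then has `x`-degree `≤ ω(T) := Σ_{c∈T} w c` at column `T`
(`natDegree_newW_single_le`, `natDegree_newW_pair_le`), with top coefficients `|T|!·q^T` (row `{new}`, `coeff_newW_single`)
and the «star sum over the zero-weight part» `starW P a q w T = Σ_{d ⊆ T, w|_d = 0} |d|!·|T∖d|!·P_a^d·q^{T∖d}` (row `{a,new}`,
`coeff_newW_pair`).

THEOREM (`det_symbMatrixW_ne_zero`, `tropical_extension`, `tropical_extension_finite`).  Let `λ : ℕ` be a threshold with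
`ω(T S) < λ` for every OLD column and `λ ≤ ω(U j)` for every NEW column (the new columns are a strict superlevel set of the
weight), let the old matrix be nonsingular and let the block `zEntryW` of top coefficients of the new rows at the new columns be
nonsingular.  Then the symbolic determinant (over `R[X]`, `R` any domain) is a nonzero polynomial, so some / all but finitely
many `x` make the table `P ⊔ {q·x^w}` nonsingular on `T ⊔ U`.  MECHANISM: row potentials `0 / λ`, column potentials
`0 / ω(U j) − λ`; after scaling old rows by `X^λ`, old columns by `X^E` and new column `j` by `X^{E − (ω(U j) − λ)}`
(`E = Σ_j ω(U j)`) every entry has degree `≤ λ + E` and the top coefficient matrix is block-triangular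
(`coeff_det_of_natDegree_le`, `Matrix.det_fromBlocks_zero₂₁`).  The rigid lemma is the case `w = 𝟙_A`, `λ = |A|`.

REACH (seat census, folder num/peelcmp.py): iterating this step («tropically peelable» families, file
`…ChowBenchmarkPairsTropicalIterate.lean`) covers 80 % of the admissible column families at (points, coordinates) = (3,4)
(3 965 of 4 950; rigid peeling: 3 048) and 58 % at (4,4) (1 739 of 3 003; rigid: 1 369); smallest new instance: the three
2-subsets of a 3-set on two points, `{∅, {0,1}, {0,2}, {1,2}}` (weights `(2,1,0)`, threshold 2).  It does NOT reach the
benchmark window `W_h` beyond the rigid heights: one-point toric degenerations expose a single Laplace term only on strict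
superlevel sets with injective zero-weight traces, and the 5-point cube `W_5 = 2^[4]` has none (memo of the seat).

WHAT THIS IS NOT: no stub of the line is closed; nothing on crux stmt-ValiantsHypothesis-14610 or on `VP` versus `VNP`.
-/

set_option linter.dupNamespace false

namespace Summit.ValiantsHypothesis.ValiantsHypothesis.Theorems.BarrierLever.ChowBenchmarkPeel

open Finset Polynomial

variable {κ : Type*} [DecidableEq κ]
variable {R : Type*} [CommRing R] {n : ℕ}

/-! ## 1. Weights -/

/-- The total weight `ω(T) = Σ_{c∈T} w c` of a column. -/
def wdeg (w : κ → ℕ) (T : Finset κ) : ℕ := ∑ c ∈ T, w c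

/-- The zero-weight part («trace») of a column. -/
def ztrace (w : κ → ℕ) (T : Finset κ) : Finset κ := T.filter fun c => w c = 0

omit [DecidableEq κ] in
/-- Weights are monotone. -/
theorem wdeg_le_of_subset (w : κ → ℕ) {d T : Finset κ} (h : d ⊆ T) : wdeg w d ≤ wdeg w T :=
  Finset.sum_le_sum_of_subset h

/-- For `d ⊆ T`: `ω(T ∖ d) = ω(T)` iff `d` lies in the zero-weight part of `T`. -/
theorem wdeg_sdiff_eq_iff (w : κ → ℕ) {d T : Finset κ} (h : d ⊆ T) :
    wdeg w (T \ d) = wdeg w T ↔ d ⊆ ztrace w T := by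
  have hs : wdeg w (T \ d) + wdeg w d = wdeg w T := Finset.sum_sdiff h
  constructor
  · intro he
    have hd0 : wdeg w d = 0 := by omega
    intro c hc
    rw [ztrace, Finset.mem_filter]
    exact ⟨h hc, (Finset.sum_eq_zero_iff.mp hd0) c hc⟩
  · intro hd
    have hd0 : wdeg w d = 0 := Finset.sum_eq_zero_iff.mpr fun c hc => (Finset.mem_filter.mp (hd hc)).2
    omega

omit [DecidableEq κ] in
/-- The monomial of the weighted point: `∏_{c∈T} (C (q c) · X^{w c}) = C (q^T) · X^{ω(T)}`. -/
theorem prod_monW (q : κ → R) (w : κ → ℕ) (T : Finset κ) :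
    (∏ c ∈ T, (C (q c) * X ^ (w c) : R[X])) = C (∏ c ∈ T, q c) * X ^ (wdeg w T) := by
  rw [Finset.prod_mul_distrib, map_prod, Finset.prod_pow_eq_pow_sum]
  rfl

/-! ## 2. The enlarged table with the weighted new point `q · X^w` -/

/-- The symbolic enlarged table: old points constant, new point `c ↦ q_c · X^{w c}`. -/
noncomputable def symbTableW (P : Fin n → κ → R) (q : κ → R) (w : κ → ℕ) : Option (Fin n) → κ → R[X] :=
  adjoin (constTable P) (fun c => C (q c) * X ^ (w c))

/-- The «star sum over the zero-weight part»: the top coefficient of the row `{a, new}`. -/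
def starW (P : Fin n → κ → R) (a : Fin n) (q : κ → R) (w : κ → ℕ) (T : Finset κ) : R :=
  ∑ d ∈ (ztrace w T).powerset, (d.card.factorial : R) * ((T \ d).card.factorial : R) *
    (∏ c ∈ d, P a c) * ∏ c ∈ T \ d, q c

/-- Row `{new}` in closed form: `C (|T|!·q^T) · X^{ω(T)}`. -/
theorem segE_newW_single (P : Fin n → κ → R) (q : κ → R) (w : κ → ℕ) (T : Finset κ) :
    segE (symbTableW P q w) {none} T = C ((T.card.factorial : R) * ∏ c ∈ T, q c) * X ^ (wdeg w T) := by
  rw [symbTableW, segE_singleton, adjoin_none, prod_monW, ← map_natCast C, map_mul, mul_assoc]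

/-- The row `{new}` has `X`-degree `≤ ω(T)`. -/
theorem natDegree_newW_single_le (P : Fin n → κ → R) (q : κ → R) (w : κ → ℕ) (T : Finset κ) :
    (segE (symbTableW P q w) {none} T).natDegree ≤ wdeg w T := by
  rw [segE_newW_single]
  exact natDegree_C_mul_X_pow_le _ _

/-- The `X^{ω(T)}`-coefficient of the row `{new}` is `|T|!·q^T`. -/
theorem coeff_newW_single (P : Fin n → κ → R) (q : κ → R) (w : κ → ℕ) (T : Finset κ) :
    (segE (symbTableW P q w) {none} T).coeff (wdeg w T) = (T.card.factorial : R) * ∏ c ∈ T, q c := by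
  rw [segE_newW_single, coeff_C_mul_X_pow, if_pos rfl]

/-- Row `{a, new}` in closed form: `Σ_{d ⊆ T} C (|d|!·|T∖d|!·P_a^d·q^{T∖d}) · X^{ω(T∖d)}`. -/
theorem segE_newW_pair (P : Fin n → κ → R) (q : κ → R) (w : κ → ℕ) (a : Fin n) (T : Finset κ) :
    segE (symbTableW P q w) {some a, none} T =
      ∑ d ∈ T.powerset, C ((d.card.factorial : R) * ((T \ d).card.factorial : R) *
        (∏ c ∈ d, P a c) * ∏ c ∈ T \ d, q c) * X ^ (wdeg w (T \ d)) := by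
  rw [symbTableW, segE_pair _ _ _ (Option.some_ne_none a)]
  refine Finset.sum_congr rfl fun d _ => ?_
  simp only [adjoin_some, adjoin_none, constTable]
  rw [prod_monW, ← map_natCast C, ← map_natCast C, ← map_prod C]
  simp only [map_mul]
  ring

/-- The row `{a, new}` has `X`-degree `≤ ω(T)`. -/
theorem natDegree_newW_pair_le (P : Fin n → κ → R) (q : κ → R) (w : κ → ℕ) (a : Fin n) (T : Finset κ) :
    (segE (symbTableW P q w) {some a, none} T).natDegree ≤ wdeg w T := by
  rw [segE_newW_pair]
  refine natDegree_sum_le_of_forall_le _ _ fun d hd => ?_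
  exact (natDegree_C_mul_X_pow_le _ _).trans (wdeg_le_of_subset w Finset.sdiff_subset)

/-- The `X^{ω(T)}`-coefficient of the row `{a, new}` is `starW P a q w T`. -/
theorem coeff_newW_pair (P : Fin n → κ → R) (q : κ → R) (w : κ → ℕ) (a : Fin n) (T : Finset κ) :
    (segE (symbTableW P q w) {some a, none} T).coeff (wdeg w T) = starW P a q w T := by
  rw [segE_newW_pair, finsetSum_coeff]
  have hterm : ∀ d ∈ T.powerset,
      (C ((d.card.factorial : R) * ((T \ d).card.factorial : R) * (∏ c ∈ d, P a c) * ∏ c ∈ T \ d, q c) *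
          X ^ (wdeg w (T \ d))).coeff (wdeg w T) =
        if d ⊆ ztrace w T then
          (d.card.factorial : R) * ((T \ d).card.factorial : R) * (∏ c ∈ d, P a c) * ∏ c ∈ T \ d, q c else 0 := by
    intro d hd
    rw [coeff_C_mul_X_pow]
    have hdT : d ⊆ T := Finset.mem_powerset.mp hd
    by_cases h : d ⊆ ztrace w T
    · rw [if_pos ((wdeg_sdiff_eq_iff w hdT).mpr h).symm, if_pos h]
    · rw [if_neg (fun e => h ((wdeg_sdiff_eq_iff w hdT).mp e.symm)), if_neg h]
  rw [Finset.sum_congr rfl hterm, ← Finset.sum_filter]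
  have hfilt : T.powerset.filter (fun d => d ⊆ ztrace w T) = (ztrace w T).powerset := by
    ext d
    rw [Finset.mem_filter, Finset.mem_powerset, Finset.mem_powerset]
    constructor
    · exact fun h => h.2
    · exact fun h => ⟨h.trans (Finset.filter_subset _ _), h⟩
  rw [hfilt, starW]

/-- Old rows of the symbolic table are constants. -/
theorem segE_symbTableW_old (P : Fin n → κ → R) (q : κ → R) (w : κ → ℕ) (S : Finset (Fin n)) (T : Finset κ) :
    segE (symbTableW P q w) (S.map Function.Embedding.some) T = C (segE P S T) := by
  rw [symbTableW, segE_adjoin_map]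
  exact (map_segE C P S T).symm

/-! ## 3. The tropical peeling lemma -/

section MainW

variable {R : Type*} [CommRing R] [IsDomain R] {n : ℕ}

/-- The block of top coefficients of the new rows: row `{new}` ↦ `|T|!·q^T`, row `{a,new}` ↦ `starW P a q w T`. -/
def zEntryW (P : Fin n → κ → R) (q : κ → R) (w : κ → ℕ) : Option (Fin n) → Finset κ → R
  | none, T => (T.card.factorial : R) * ∏ c ∈ T, q c
  | some a, T => starW P a q w T

/-- The symbolic segment-moment matrix of `P ⊔ {q·X^w}` on the columns `T ⊔ U`, over `R[X]`. -/
noncomputable def symbMatrixW (P : Fin n → κ → R) (q : κ → R) (w : κ → ℕ) (T : Row n → Finset κ)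
    (U : Option (Fin n) → Finset κ) : Matrix (Row n ⊕ Option (Fin n)) (Row n ⊕ Option (Fin n)) R[X] :=
  Matrix.of fun i j => segE (symbTableW P q w) (rowSet i) (Sum.elim T U j)

omit [IsDomain R] in
/-- Evaluating at `x` gives the segment-moment matrix of the table `P ⊔ {c ↦ q_c · x^{w c}}`. -/
theorem eval_det_symbMatrixW (P : Fin n → κ → R) (q : κ → R) (w : κ → ℕ) (T : Row n → Finset κ)
    (U : Option (Fin n) → Finset κ) (x : R) :
    (symbMatrixW P q w T U).det.eval x = (Matrix.of fun i j : Row n ⊕ Option (Fin n) =>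
      segE (adjoin P (fun c => q c * x ^ (w c))) (rowSet i) (Sum.elim T U j)).det := by
  classical
  have h1 : (Polynomial.evalRingHom x) (symbMatrixW P q w T U).det =
      ((Polynomial.evalRingHom x).mapMatrix (symbMatrixW P q w T U)).det :=
    RingHom.map_det _ _
  rw [Polynomial.coe_evalRingHom] at h1
  rw [h1]
  congr 1
  ext i j
  rw [RingHom.mapMatrix_apply, Matrix.map_apply, symbMatrixW, Matrix.of_apply, Matrix.of_apply,
    Polynomial.coe_evalRingHom, ← Polynomial.coe_evalRingHom, map_segE]
  congr 1
  funext o c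
  cases o with
  | none => simp [symbTableW, adjoin_none, Polynomial.coe_evalRingHom]
  | some a => simp [symbTableW, constTable]

/-- **The tropical peeling lemma (symbolic form).**  Hypotheses: a threshold `lam` with every OLD column of weight
`< lam` and every NEW column of weight `≥ lam`; the old matrix is nonsingular; the block `zEntryW` of top coefficients of
the new rows at the new columns is nonsingular.  Then the symbolic determinant is a nonzero polynomial in `x`. -/
theorem det_symbMatrixW_ne_zero (P : Fin n → κ → R) (q : κ → R) (w : κ → ℕ) (T : Row n → Finset κ)
    (U : Option (Fin n) → Finset κ) (lam : ℕ) (hT : ∀ S, wdeg w (T S) < lam) (hU : ∀ j, lam ≤ wdeg w (U j))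
    (hold : (Matrix.of fun S S' : Row n => segE P S.1 (T S')).det ≠ 0)
    (hZ : (Matrix.of fun i j : Option (Fin n) => zEntryW P q w i (U j)).det ≠ 0) :
    (symbMatrixW P q w T U).det ≠ 0 := by
  classical
  set MX := symbMatrixW P q w T U with hMX0
  have hMX : MX = Matrix.of fun i j => segE (symbTableW P q w) (rowSet i) (Sum.elim T U j) := rfl
  -- potentials: rows `lam / 0` (as scaling exponents of old / new rows), columns `E / E - (ω(U j) - lam)`
  set E : ℕ := ∑ j, wdeg w (U j) with hE
  have hEj : ∀ j, wdeg w (U j) - lam ≤ E := fun j =>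
    (Nat.sub_le _ _).trans (Finset.single_le_sum (fun j _ => Nat.zero_le (wdeg w (U j))) (Finset.mem_univ j))
  set rw : Row n ⊕ Option (Fin n) → R[X] := Sum.elim (fun _ => X ^ lam) (fun _ => 1) with hrw
  set cw : Row n ⊕ Option (Fin n) → R[X] :=
    Sum.elim (fun _ => X ^ E) (fun j => X ^ (E - (wdeg w (U j) - lam))) with hcw
  set MX' : Matrix (Row n ⊕ Option (Fin n)) (Row n ⊕ Option (Fin n)) R[X] :=
    Matrix.of fun i j => rw i * (cw j * MX i j) with hMX'
  have hdet' : MX'.det = (∏ i, rw i) * ((∏ j, cw j) * MX.det) := by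
    rw [hMX', ← Matrix.det_mul_row cw MX]
    exact Matrix.det_mul_column rw _
  suffices hne' : MX'.det ≠ 0 by
    intro h0; apply hne'; rw [hdet', h0, mul_zero, mul_zero]
  -- uniform degree bound `lam + E`
  have hdeg : ∀ i j, (MX' i j).natDegree ≤ lam + E := by
    intro i j
    rw [hMX', Matrix.of_apply, hMX, Matrix.of_apply]
    cases i with
    | inl S =>
      rw [hrw, Sum.elim_inl, rowSet, segE_symbTableW_old]
      cases j with
      | inl S' =>
        rw [hcw, Sum.elim_inl, Sum.elim_inl, ← mul_assoc, ← pow_add]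
        calc (X ^ (lam + E) * C (segE P S.1 (T S'))).natDegree ≤ (X ^ (lam + E) : R[X]).natDegree :=
              natDegree_mul_C_le _ _
          _ ≤ lam + E := natDegree_X_pow_le _
      | inr j' =>
        rw [hcw, Sum.elim_inr, Sum.elim_inr, ← mul_assoc, ← pow_add]
        calc (X ^ (lam + (E - (wdeg w (U j') - lam))) * C (segE P S.1 (U j'))).natDegree
            ≤ (X ^ (lam + (E - (wdeg w (U j') - lam))) : R[X]).natDegree := natDegree_mul_C_le _ _
          _ ≤ lam + (E - (wdeg w (U j') - lam)) := natDegree_X_pow_le _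
          _ ≤ lam + E := by omega
    | inr o =>
      rw [hrw, Sum.elim_inr, one_mul]
      cases j with
      | inl S' =>
        rw [hcw, Sum.elim_inl, Sum.elim_inl]
        have hd : (segE (symbTableW P q w) (rowSet (Sum.inr o)) (T S')).natDegree ≤ wdeg w (T S') := by
          cases o with
          | none => exact natDegree_newW_single_le P q w _
          | some a => exact natDegree_newW_pair_le P q w a _
        calc (X ^ E * segE (symbTableW P q w) (rowSet (Sum.inr o)) (T S')).natDegree
            ≤ (X ^ E : R[X]).natDegree + (segE (symbTableW P q w) (rowSet (Sum.inr o)) (T S')).natDegree :=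
              natDegree_mul_le
          _ ≤ E + wdeg w (T S') := add_le_add (natDegree_X_pow_le _) hd
          _ ≤ lam + E := by have := hT S'; omega
      | inr j' =>
        rw [hcw, Sum.elim_inr, Sum.elim_inr]
        have hd : (segE (symbTableW P q w) (rowSet (Sum.inr o)) (U j')).natDegree ≤ wdeg w (U j') := by
          cases o with
          | none => exact natDegree_newW_single_le P q w _
          | some a => exact natDegree_newW_pair_le P q w a _
        calc (X ^ (E - (wdeg w (U j') - lam)) * segE (symbTableW P q w) (rowSet (Sum.inr o)) (U j')).natDegree
            ≤ (X ^ (E - (wdeg w (U j') - lam)) : R[X]).natDegree +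
                (segE (symbTableW P q w) (rowSet (Sum.inr o)) (U j')).natDegree := natDegree_mul_le
          _ ≤ (E - (wdeg w (U j') - lam)) + wdeg w (U j') := add_le_add (natDegree_X_pow_le _) hd
          _ ≤ lam + E := by have := hU j'; have := hEj j'; omega
  -- the top-coefficient matrix is block-triangular
  have h21 : ∀ (o : Option (Fin n)) (S' : Row n), (MX' (Sum.inr o) (Sum.inl S')).coeff (lam + E) = 0 := by
    intro o S'
    apply coeff_eq_zero_of_natDegree_lt
    rw [hMX', Matrix.of_apply, hMX, Matrix.of_apply, hrw, Sum.elim_inr, one_mul, hcw, Sum.elim_inl, Sum.elim_inl]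
    have hd : (segE (symbTableW P q w) (rowSet (Sum.inr o)) (T S')).natDegree ≤ wdeg w (T S') := by
      cases o with
      | none => exact natDegree_newW_single_le P q w _
      | some a => exact natDegree_newW_pair_le P q w a _
    calc (X ^ E * segE (symbTableW P q w) (rowSet (Sum.inr o)) (T S')).natDegree
        ≤ (X ^ E : R[X]).natDegree + (segE (symbTableW P q w) (rowSet (Sum.inr o)) (T S')).natDegree :=
          natDegree_mul_le
      _ ≤ E + wdeg w (T S') := add_le_add (natDegree_X_pow_le _) hd
      _ < lam + E := by have := hT S'; omega
  have h22 : ∀ (o j' : Option (Fin n)), (MX' (Sum.inr o) (Sum.inr j')).coeff (lam + E) = zEntryW P q w o (U j') := by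
    intro o j'
    rw [hMX', Matrix.of_apply, hMX, Matrix.of_apply, hrw, Sum.elim_inr, one_mul, hcw, Sum.elim_inr, Sum.elim_inr,
      coeff_X_pow_mul']
    have hle : E - (wdeg w (U j') - lam) ≤ lam + E := by omega
    have heq : lam + E - (E - (wdeg w (U j') - lam)) = wdeg w (U j') := by
      have := hU j'; have := hEj j'; omega
    rw [if_pos hle, heq]
    cases o with
    | none => rw [rowSet, coeff_newW_single, zEntryW]
    | some a => rw [rowSet, coeff_newW_pair, zEntryW]
  have h11 : ∀ S S' : Row n, (MX' (Sum.inl S) (Sum.inl S')).coeff (lam + E) = segE P S.1 (T S') := by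
    intro S S'
    rw [hMX', Matrix.of_apply, hMX, Matrix.of_apply, hrw, Sum.elim_inl, hcw, Sum.elim_inl, Sum.elim_inl, rowSet,
      segE_symbTableW_old, ← mul_assoc, ← pow_add, coeff_X_pow_mul', if_pos le_rfl, Nat.sub_self, coeff_C_zero]
  have htop : (Matrix.of fun i j => (MX' i j).coeff (lam + E)) =
      Matrix.fromBlocks (Matrix.of fun S S' : Row n => segE P S.1 (T S'))
        (Matrix.of fun (S : Row n) (j : Option (Fin n)) => (MX' (Sum.inl S) (Sum.inr j)).coeff (lam + E))
        0 (Matrix.of fun i j : Option (Fin n) => zEntryW P q w i (U j)) := by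
    ext i j
    rcases i with S | o <;> rcases j with S' | j'
    · rw [Matrix.of_apply, Matrix.fromBlocks_apply₁₁, Matrix.of_apply, h11]
    · rw [Matrix.of_apply, Matrix.fromBlocks_apply₁₂, Matrix.of_apply]
    · rw [Matrix.of_apply, Matrix.fromBlocks_apply₂₁, Matrix.zero_apply, h21]
    · rw [Matrix.of_apply, Matrix.fromBlocks_apply₂₂, Matrix.of_apply, h22]
  have hcoeff : MX'.det.coeff (Fintype.card (Row n ⊕ Option (Fin n)) * (lam + E)) ≠ 0 := by
    rw [coeff_det_of_natDegree_le MX' (lam + E) hdeg, htop, Matrix.det_fromBlocks_zero₂₁]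
    exact mul_ne_zero hold hZ
  intro h0
  rw [h0, coeff_zero] at hcoeff
  exact hcoeff rfl

/-- **Tropical peeling lemma, cofinite form**: all but finitely many `x` make `P ⊔ {q·x^w}` nonsingular on `T ⊔ U`. -/
theorem tropical_extension_finite (P : Fin n → κ → R) (q : κ → R) (w : κ → ℕ) (T : Row n → Finset κ)
    (U : Option (Fin n) → Finset κ) (lam : ℕ) (hT : ∀ S, wdeg w (T S) < lam) (hU : ∀ j, lam ≤ wdeg w (U j))
    (hold : (Matrix.of fun S S' : Row n => segE P S.1 (T S')).det ≠ 0)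
    (hZ : (Matrix.of fun i j : Option (Fin n) => zEntryW P q w i (U j)).det ≠ 0) :
    Set.Finite {x : R | (Matrix.of fun i j : Row n ⊕ Option (Fin n) =>
      segE (adjoin P (fun c => q c * x ^ (w c))) (rowSet i) (Sum.elim T U j)).det = 0} := by
  have hne := det_symbMatrixW_ne_zero P q w T U lam hT hU hold hZ
  refine (Polynomial.finite_setOf_isRoot hne).subset fun x hx => ?_
  rw [Set.mem_setOf_eq, Polynomial.IsRoot.def, eval_det_symbMatrixW]
  exact hx

/-- **Tropical peeling lemma** (needs infinitely many scalars, e.g. characteristic zero): some `x` makes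
`P ⊔ {q·x^w}` nonsingular on `T ⊔ U`. -/
theorem tropical_extension [Infinite R] (P : Fin n → κ → R) (q : κ → R) (w : κ → ℕ) (T : Row n → Finset κ)
    (U : Option (Fin n) → Finset κ) (lam : ℕ) (hT : ∀ S, wdeg w (T S) < lam) (hU : ∀ j, lam ≤ wdeg w (U j))
    (hold : (Matrix.of fun S S' : Row n => segE P S.1 (T S')).det ≠ 0)
    (hZ : (Matrix.of fun i j : Option (Fin n) => zEntryW P q w i (U j)).det ≠ 0) :
    ∃ x : R, (Matrix.of fun i j : Row n ⊕ Option (Fin n) =>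
      segE (adjoin P (fun c => q c * x ^ (w c))) (rowSet i) (Sum.elim T U j)).det ≠ 0 := by
  have hfin := tropical_extension_finite P q w T U lam hT hU hold hZ
  obtain ⟨x, hx⟩ := Set.Infinite.nonempty (Set.Finite.infinite_compl hfin)
  exact ⟨x, hx⟩

/-! ### The rigid lemma is the case `w = 𝟙_A`, `lam = |A|` -/

omit [IsDomain R] in
/-- For the indicator weight `𝟙_A`: `ω(T) = |T ∩ A|`. -/
theorem wdeg_indicator (A T : Finset κ) : wdeg (fun c => if c ∈ A then 1 else 0) T = (T ∩ A).card := by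
  rw [wdeg, Finset.sum_boole, Finset.filter_mem_eq_inter]
  rfl

omit [IsDomain R] in
/-- Hence the threshold conditions of the tropical lemma at `w = 𝟙_A`, `lam = |A|` are exactly the hypotheses
`A ⊄ T S` / `A ⊆ U j` of the rigid peeling lemma. -/
theorem wdeg_indicator_lt_iff (A T : Finset κ) :
    wdeg (fun c => if c ∈ A then 1 else 0) T < A.card ↔ ¬ A ⊆ T := by
  rw [wdeg_indicator]
  constructor
  · intro h hA
    have : (T ∩ A) = A := Finset.inter_eq_right.mpr hA
    rw [this] at h
    exact lt_irrefl _ h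
  · intro h
    refine Finset.card_lt_card (Finset.ssubset_iff_subset_ne.mpr ⟨Finset.inter_subset_right, fun e => h ?_⟩)
    rw [← e]
    exact Finset.inter_subset_left

omit [IsDomain R] in
/-- (companion) `|A| ≤ ω_{𝟙_A}(T) ↔ A ⊆ T`. -/
theorem le_wdeg_indicator_iff (A T : Finset κ) :
    A.card ≤ wdeg (fun c => if c ∈ A then 1 else 0) T ↔ A ⊆ T := by
  rw [← not_lt, wdeg_indicator_lt_iff, not_not]

end MainW

end Summit.ValiantsHypothesis.ValiantsHypothesis.Theorems.BarrierLever.ChowBenchmarkPeel
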